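import Literature.MathematicalPhysics.QuantumFieldTheory.Balaban1983to89.B6SectACriticalPointV1
import HarnessLib

/-!
# DAG node N07 ([B11] Sect. F data side, BRIDGE-92-B road R0′) — PRINT'S `H` ON A COARSE PURE GAUGE IS A FINE PURE GAUGE,
# and the flat kernel of [B6] (2.5)/(2.6)/(2.12) is insensitive to curl-factoring perturbations `Q ↦ Q + T∘curl` of the
# constraint operator (road R4's `Q♯`) — hypothesis-form, abstract [B6] Sect. A carriers

Width seat `pub-ymgap-dag-n07-w7` (g0), `--supports stmt-QuantumFields-20542 --as helper`; count-neutral; 0 `def`, 0 `sorry`.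
Companion of the located note `HOME/pub-ymgap-dag-n07-w7/ROAD-CHECK-R4-R0prime.md` (exact rational small-lattice checks there).

THE QUESTION (dag-n07-e g19, `STUB1-SECTF-MAP.md` § BRIDGE-92-B, road R0′, *decisive sub-question*): does print's `H`
— [Balaban1985Variational] (45) p. 285, [Balaban1984PropagatorsII] (2.35) `H = GQ*(QGQ*)⁻¹`, THE critical configuration
of the functional (2.5) `A ↦ Σ_p|(∂A)(p)|²` on `{QA = B, R∂*A = 0}` (tree `B6Eq218Lagrangian.energy/Admissible/IsCritical`,
`isCritical_hOp`, `isCritical_unique`) — send a coarse pure gauge `B = ∂_coarse λ` to a fine pure gauge `∂μ`?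

ANSWER (this file, §1–§2): YES, whenever ONE admissible pure gauge exists — because the functional is `‖curl A‖²`
(NOT the Hodge form), a pure gauge has energy `0`, a critical configuration is a global minimiser
(`energy_le_of_isCritical`), hence THE critical configuration is curl-free and, by uniqueness, IS that pure gauge.
Feasibility (§2) is two lines when the vector averaging `Q` intertwines gradients with the SAME scalar averaging `Q′`
whose kernel defines `R` ((2.10)–(2.12): `R` idempotent with range in `∂*∂(N(Q′))` — tree `B6SectAOperatorsV1.RE_comp_RE`,
`RE_range`): given `λ = Q′μ₀`, pick `n ∈ N(Q′)` with `R(∂*∂μ₀) = ∂*∂n` and take `μ := μ₀ − n`.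
§3 (road R4's `Q♯ = LʲηQ_{B5} + ∂_c∘𝒦∘curl`): for `Q♯ := Q + T∘curl` with ANY linear `T`, admissibility and criticality of a
CURL-FREE configuration are the same for `Q♯` and `Q`, so the flat kernel `{curl A = 0 ∧ R∂*A = 0 ∧ QA = 0}` — whose
triviality is the positivity of `Δ_a` on closed forms — is unchanged, and §1–§2 transfer verbatim to `Q♯`.

WHAT IS PROVED (namespace `Summit.QuantumFields.YangMills.Theorems.N07FlatHOfCoarseGradient`; carriers `P A V W` of
`B6Eq218Lagrangian` — plaquette fields, vector fields, fine scalars, multi-scale data — plus a coarse scalar module `Vc`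
with `dcoarse : Vc →ₗ W` and an intertwiner `E : V →ₗ Vc`; every operator identity is a displayed hypothesis).
* §1 `isCritical_of_admissible_of_dc_eq_zero` · `dc_eq_zero_of_isCritical` · `admissible_grad_iff` · `isCritical_grad` ·
  `eq_grad_of_isCritical_of_unique` · ★ `hOp_coarseGradient_eq_grad` (with the inputs of the tree's `isCritical_unique`:
  `B6SectA.hOp G Qs Einv (dcoarse λ) = d μ`, hence `dc (H(∂_cλ)) = 0`).
* §2 ★ `exists_admissible_grad_of_matched` (feasibility, matched case) · `hOp_coarseGradient_eq_grad_of_matched`.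
* §3 `admissible_curlShift_iff` · `isCritical_curlShift_iff_of_dc_eq_zero` · ★ `flat_kernel_curlShift_iff` · `form219_eq_zero_iff` ·
  `hOp_curlShift_coarseGradient_eq_grad`.
* §4 PRINT'S OWN MODEL, UNCONDITIONALLY: on lit-balaban p21/r03's concrete [B6] Sect. A model (`B6SectAOperatorsV1`/`VectorModelV1`/
  `CriticalPointV1`: the fine torus of `P : Params`, every nested family `D : Domains P`, the multi-scale straight averages
  `Q` (2.20), `R` (2.10)–(2.12), `H = GQ*(QGQ*)⁻¹` with `G = Δ_a⁻¹`) — ★★ `hOp_QE_dE_eq_dE_V1`: for EVERY scalar `μ₀`,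
  `H(Q(∂μ₀)) = ∂(μ₀ − n)` with `n ∈ N(Q′)`, `R(∂*∂μ₀) = ∂*∂n` (and `Q(∂μ₀) = ∂^{(j)}Q′_jμ₀` on `Λ_j` is the coarse pure gauge
  by (1.20), `B6SectADomainsV1` header); `dcE_hOp_QE_dE_V1`: its plaquette variables vanish. No hypothesis beyond `c ≠ 0`, `w > 0`.
HONEST SCOPE.  Finite-dimensional linear algebra over the tree's [B6] Sect. A letters; no estimate; the record-side
instantiation (the (0.4) average of record intertwines gradients with CENTRE VALUES, `AlphaInputsT3ACv3AbelianLiftAvg.linAvg04_cobd`,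
so feasibility there is the S4 lane's positivity letter) is NOT in this file.  Nothing of [B11] Sect. F's analysis is
asserted; N07 is not discharged; nothing here bears on the continuum, OS, or the mass gap.

References: T. Bałaban, CMP **96** (1984) 223–250 [Balaban1984PropagatorsII] (2.5)–(2.6) p.224, (2.9)–(2.12) p.225,
(2.19)–(2.21) p.226, (2.35) p.228; CMP **102** (1985) 277–309 [Balaban1985Variational] (45)–(46) p.285, (157) p.302;
CMP **95** (1984) 17–40 [Balaban1984PropagatorsI] (1.20) p.20 (`Q∂ = ∂Q′`).
-/

set_option autoImplicit false

noncomputable section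

open scoped InnerProductSpace

namespace Summit.QuantumFields.YangMills.Theorems.N07FlatHOfCoarseGradient

open Literature.MathematicalPhysics.QuantumFieldTheory.Balaban1983to89
open B6Eq218Lagrangian (energy Admissible tangent IsCritical mem_tangent_iff energy_le_of_isCritical energy_nonneg
  isCritical_unique isCritical_hOp)
open B6SectADomainsV1 (Domains)
open B6SectAOperatorsV1 (ScalarSpace BondIdx BondIdxSpace dE dsE dcE QE QsE QpE RE RE_range RE_comp_RE)
open B6SectAVectorModelV1 (GE EE)
open B6SectACriticalPointV1 (dcE_comp_dE QE_dE_eq_zero isCritical_iff_eq_hOp)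

variable {P A V W Vc : Type*}
  [NormedAddCommGroup P] [InnerProductSpace ℝ P]
  [NormedAddCommGroup A] [InnerProductSpace ℝ A]
  [NormedAddCommGroup V] [InnerProductSpace ℝ V]
  [NormedAddCommGroup W] [InnerProductSpace ℝ W]
  [AddCommGroup Vc] [Module ℝ Vc]

/-! ## §1 A flat admissible competitor forces THE critical configuration to be flat — and to be that competitor -/

section Flat

variable {dc : A →ₗ[ℝ] P} {Q : A →ₗ[ℝ] W} {dstar : A →ₗ[ℝ] V} {Rp : V →ₗ[ℝ] V} {B : W}

/-- An admissible configuration with `∂A = 0` (zero plaquette variables) is a critical configuration of (2.5) on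
(2.6)∧(2.12): the first variation `2⟨∂A, ∂v⟩` vanishes identically. [cite: Balaban1984PropagatorsII, (2.5)–(2.6) p.224 + (2.12) p.225] -/
theorem isCritical_of_admissible_of_dc_eq_zero {x : A} (hx : Admissible Q dstar Rp B x) (h0 : dc x = 0) :
    IsCritical dc Q dstar Rp B x :=
  ⟨hx, fun v _ => by rw [h0, inner_zero_left]⟩

/-- If SOME admissible configuration is flat, EVERY critical configuration is flat (a critical configuration minimises
`‖∂A‖²` on the admissible set, `energy_le_of_isCritical`, and the minimum is then `0`).
[cite: Balaban1984PropagatorsII, (2.5)–(2.6) p.224 + p.226 before (2.18)] -/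
theorem dc_eq_zero_of_isCritical {x : A} (hx : IsCritical dc Q dstar Rp B x)
    (hflat : ∃ y, Admissible Q dstar Rp B y ∧ dc y = 0) : dc x = 0 := by
  obtain ⟨y, hy, hy0⟩ := hflat
  have hle := energy_le_of_isCritical dc dstar Rp Q B hx hy
  have hy0' : energy dc y = 0 := by simp [energy, hy0]
  have hx0 : energy dc x = 0 := le_antisymm (hy0' ▸ hle) (energy_nonneg dc x)
  have hnorm : ‖dc x‖ = 0 := by
    have h2 : ‖dc x‖ ^ 2 = 0 := hx0
    exact pow_eq_zero_iff (n := 2) two_ne_zero |>.mp h2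
  exact norm_eq_zero.mp hnorm

/-- With uniqueness of critical configurations (the conclusion of the tree's `isCritical_unique` /
`existsUnique_isCritical`), a critical configuration EQUALS any flat admissible competitor.
[cite: Balaban1984PropagatorsII, (2.35) p.228] -/
theorem eq_of_isCritical_of_unique {x y : A}
    (huniq : ∀ x' y' : A, IsCritical dc Q dstar Rp B x' → IsCritical dc Q dstar Rp B y' → x' = y')
    (hx : IsCritical dc Q dstar Rp B x) (hy : Admissible Q dstar Rp B y) (hy0 : dc y = 0) : x = y :=
  huniq x y hx (isCritical_of_admissible_of_dc_eq_zero hy hy0)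

end Flat

/-! ## §1′ Pure gauges: `∂μ` at the datum `∂_coarse λ` -/

section PureGauge

variable {dc : A →ₗ[ℝ] P} {Q : A →ₗ[ℝ] W} {dstar : A →ₗ[ℝ] V} {Rp : V →ₗ[ℝ] V}
  {d : V →ₗ[ℝ] A} {dcoarse : Vc →ₗ[ℝ] W} {E : V →ₗ[ℝ] Vc}

/-- Under the intertwining `Q∂ = ∂_c E` (print: `Q(∂λ) = ∂(Q′λ)`, [Balaban1984PropagatorsI] (1.20); at the (0.4) average of
record `E` is the centre value, `linAvg04_cobd`), the pure gauge `∂μ` is admissible at the datum `∂_cλ` iff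
`∂_c(Eμ) = ∂_cλ` and `R∂*∂μ = 0`. [cite: Balaban1984PropagatorsII, (2.6) p.224 + (2.12) p.225; Balaban1984PropagatorsI, (1.20) p.20] -/
theorem admissible_grad_iff (hQd : Q ∘ₗ d = dcoarse ∘ₗ E) (lam : Vc) (μ : V) :
    Admissible Q dstar Rp (dcoarse lam) (d μ) ↔ dcoarse (E μ) = dcoarse lam ∧ Rp (dstar (d μ)) = 0 := by
  have h : Q (d μ) = dcoarse (E μ) := by
    simpa only [LinearMap.coe_comp, Function.comp_apply] using LinearMap.congr_fun hQd μ
  simp only [Admissible, h]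

/-- An admissible pure gauge is a critical configuration (`∂∂μ = 0`: `curl ∘ grad = 0`).
[cite: Balaban1984PropagatorsII, (2.5)–(2.6) p.224 + (2.12) p.225] -/
theorem isCritical_grad (hdcd : dc ∘ₗ d = 0) {B : W} {μ : V} (hμ : Admissible Q dstar Rp B (d μ)) :
    IsCritical dc Q dstar Rp B (d μ) :=
  isCritical_of_admissible_of_dc_eq_zero hμ (by simpa using LinearMap.congr_fun hdcd μ)

/-- If a pure gauge is admissible at the datum `B`, every critical configuration at `B` is curl-free.
[cite: Balaban1984PropagatorsII, (2.5)–(2.6) p.224 + (2.35) p.228] -/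
theorem dc_eq_zero_of_isCritical_of_admissible_grad (hdcd : dc ∘ₗ d = 0) {B : W}
    (hfeas : ∃ μ : V, Admissible Q dstar Rp B (d μ)) {x : A} (hx : IsCritical dc Q dstar Rp B x) : dc x = 0 := by
  obtain ⟨μ, hμ⟩ := hfeas
  exact dc_eq_zero_of_isCritical hx ⟨d μ, hμ, by simpa using LinearMap.congr_fun hdcd μ⟩

/-- With uniqueness of critical configurations, THE critical configuration at `B` is the admissible pure gauge.
[cite: Balaban1984PropagatorsII, (2.35) p.228] -/
theorem eq_grad_of_isCritical_of_unique (hdcd : dc ∘ₗ d = 0) {B : W}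
    (huniq : ∀ x' y' : A, IsCritical dc Q dstar Rp B x' → IsCritical dc Q dstar Rp B y' → x' = y')
    (hfeas : ∃ μ : V, Admissible Q dstar Rp B (d μ)) {x : A} (hx : IsCritical dc Q dstar Rp B x) :
    ∃ μ : V, Admissible Q dstar Rp B (d μ) ∧ x = d μ := by
  obtain ⟨μ, hμ⟩ := hfeas
  exact ⟨μ, hμ, eq_of_isCritical_of_unique huniq hx hμ (by simpa using LinearMap.congr_fun hdcd μ)⟩

end PureGauge

/-! ## §1″ The statement for print's `H = GQ*(QGQ*)⁻¹` (2.35), with the inputs of the tree's `isCritical_unique` -/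

section HOp

variable (ΔA : A →ₗ[ℝ] A) (a : W →ₗ[ℝ] W) (dc : A →ₗ[ℝ] P) (dcs : P →ₗ[ℝ] A) (d : V →ₗ[ℝ] A)
  (dstar : A →ₗ[ℝ] V) (Rp : V →ₗ[ℝ] V) (Q : A →ₗ[ℝ] W) (Qs : W →ₗ[ℝ] A)

/-- **`H` of a datum admitting a pure gauge IS that pure gauge.**  Under the inputs of [Balaban1984PropagatorsII] Sect. A as
typed in `B6Eq218Lagrangian.isCritical_unique` (`Δ_a = ∂*∂ + ∂R∂* + Q*aQ` (2.19) with left inverse `G`, adjoint pairs,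
`R` an orthogonal projection, the Faddeev–Popov identities (2.31)/(2.34), `E` a two-sided inverse of `QGQ*`) and
`curl ∘ grad = 0`: if some pure gauge `∂μ` is admissible at `B`, then `HB = ∂μ` — in particular `∂(HB) = 0`.
[cite: Balaban1984PropagatorsII, (2.35) p.228; Balaban1985Variational, (45)-(46) p.285] -/
theorem hOp_eq_grad_of_admissible_grad [FiniteDimensional ℝ A]
    (hΔa : ΔA = dcs ∘ₗ dc + d ∘ₗ Rp ∘ₗ dstar + Qs ∘ₗ a ∘ₗ Q)
    (hdc : ∀ (p : P) (x : A), ⟪dcs p, x⟫_ℝ = ⟪p, dc x⟫_ℝ)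
    (hd : ∀ (v : V) (x : A), ⟪d v, x⟫_ℝ = ⟪v, dstar x⟫_ℝ) (hR : ∀ u v : V, ⟪Rp u, v⟫_ℝ = ⟪u, Rp v⟫_ℝ)
    (hRR : Rp ∘ₗ Rp = Rp) (hQ : ∀ (w : W) (x : A), ⟪Qs w, x⟫_ℝ = ⟪w, Q x⟫_ℝ)
    (G : A →ₗ[ℝ] A) (Einv : W →ₗ[ℝ] W) (hG : G ∘ₗ ΔA = LinearMap.id)
    (h231 : Rp ∘ₗ dstar ∘ₗ G ∘ₗ d ∘ₗ Rp = Rp) (h234 : Rp ∘ₗ dstar ∘ₗ G ∘ₗ Qs = 0)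
    (hE : Einv ∘ₗ (Q ∘ₗ G ∘ₗ Qs) = LinearMap.id)
    (hdcd : dc ∘ₗ d = 0) {B : W} {μ : V} (hμ : Admissible Q dstar Rp B (d μ)) :
    B6SectA.hOp G Qs Einv B = d μ :=
  (isCritical_unique ΔA a dc dcs d dstar Rp Q Qs B hΔa hdc hd hR hRR hQ G Einv hG h231 h234 hE
    (isCritical_grad hdcd hμ)).symm

/-- **★ `H(∂_coarse λ)` is a fine pure gauge** (the R0′ sub-question of BRIDGE-92-B): with the intertwining `Q∂ = ∂_cE`
and ONE `μ` with `∂_c(Eμ) = ∂_cλ`, `R∂*∂μ = 0`, print's `H` gives `H(∂_cλ) = ∂μ` and `∂(H(∂_cλ)) = 0`.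
[cite: Balaban1984PropagatorsII, (2.35) p.228; Balaban1985Variational, (45) p.285, (157) p.302] -/
theorem hOp_coarseGradient_eq_grad [FiniteDimensional ℝ A]
    (hΔa : ΔA = dcs ∘ₗ dc + d ∘ₗ Rp ∘ₗ dstar + Qs ∘ₗ a ∘ₗ Q)
    (hdc : ∀ (p : P) (x : A), ⟪dcs p, x⟫_ℝ = ⟪p, dc x⟫_ℝ)
    (hd : ∀ (v : V) (x : A), ⟪d v, x⟫_ℝ = ⟪v, dstar x⟫_ℝ) (hR : ∀ u v : V, ⟪Rp u, v⟫_ℝ = ⟪u, Rp v⟫_ℝ)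
    (hRR : Rp ∘ₗ Rp = Rp) (hQ : ∀ (w : W) (x : A), ⟪Qs w, x⟫_ℝ = ⟪w, Q x⟫_ℝ)
    (G : A →ₗ[ℝ] A) (Einv : W →ₗ[ℝ] W) (hG : G ∘ₗ ΔA = LinearMap.id)
    (h231 : Rp ∘ₗ dstar ∘ₗ G ∘ₗ d ∘ₗ Rp = Rp) (h234 : Rp ∘ₗ dstar ∘ₗ G ∘ₗ Qs = 0)
    (hE : Einv ∘ₗ (Q ∘ₗ G ∘ₗ Qs) = LinearMap.id)
    (hdcd : dc ∘ₗ d = 0) (dcoarse : Vc →ₗ[ℝ] W) (E : V →ₗ[ℝ] Vc) (hQd : Q ∘ₗ d = dcoarse ∘ₗ E)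
    {lam : Vc} {μ : V} (hEμ : dcoarse (E μ) = dcoarse lam) (hRμ : Rp (dstar (d μ)) = 0) :
    B6SectA.hOp G Qs Einv (dcoarse lam) = d μ ∧ dc (B6SectA.hOp G Qs Einv (dcoarse lam)) = 0 := by
  have hμ : Admissible Q dstar Rp (dcoarse lam) (d μ) := (admissible_grad_iff hQd lam μ).mpr ⟨hEμ, hRμ⟩
  have h := hOp_eq_grad_of_admissible_grad ΔA a dc dcs d dstar Rp Q Qs hΔa hdc hd hR hRR hQ G Einv hG h231 h234 hE
    hdcd hμ
  exact ⟨h, by rw [h]; simpa using LinearMap.congr_fun hdcd μ⟩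

end HOp

/-! ## §2 Feasibility in the MATCHED case: `Q∂ = ∂_cQ′` with the same `Q′` whose kernel defines `R` ((2.10)–(2.12)) -/

section Matched

variable {Q : A →ₗ[ℝ] W} {dstar : A →ₗ[ℝ] V} {Rp : V →ₗ[ℝ] V}
  {d : V →ₗ[ℝ] A} {dcoarse : Vc →ₗ[ℝ] W} {Qp : V →ₗ[ℝ] Vc}

/-- **★ Feasibility of a pure gauge, matched case** — (2.9)/(2.12) read backwards: `R` is idempotent with range inside
`∂*∂(N(Q′))` (tree, concrete `R`: `B6SectAOperatorsV1.RE_comp_RE`, `RE_range`) and `Q∂ = ∂_cQ′` for THE SAME `Q′`;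
then for `λ = Q′μ₀` the pure gauge `∂(μ₀ − n)`, where `n ∈ N(Q′)` has `R(∂*∂μ₀) = ∂*∂n`, is admissible at `∂_cλ`.
[cite: Balaban1984PropagatorsII, (2.9)–(2.12) p.225; Balaban1984PropagatorsI, (1.20) p.20] -/
theorem exists_admissible_grad_of_matched (hQd : Q ∘ₗ d = dcoarse ∘ₗ Qp) (hRR : Rp ∘ₗ Rp = Rp)
    (hRrange : ∀ v : V, ∃ n ∈ LinearMap.ker Qp, Rp v = dstar (d n)) (μ₀ : V) :
    ∃ μ : V, Admissible Q dstar Rp (dcoarse (Qp μ₀)) (d μ) := by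
  obtain ⟨n, hn, hRn⟩ := hRrange (dstar (d μ₀))
  refine ⟨μ₀ - n, (admissible_grad_iff hQd (Qp μ₀) (μ₀ - n)).mpr ⟨?_, ?_⟩⟩
  · rw [map_sub, LinearMap.mem_ker.mp hn, sub_zero]
  · have hRRv : Rp (Rp (dstar (d μ₀))) = Rp (dstar (d μ₀)) := by
      simpa only [LinearMap.coe_comp, Function.comp_apply] using LinearMap.congr_fun hRR (dstar (d μ₀))
    rw [map_sub, map_sub, map_sub, ← hRn, hRRv, sub_self]

/-- Every datum `∂_cλ` with `λ` in the range of `Q′` (e.g. `Q′` onto) admits an admissible pure gauge (matched case).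
[cite: Balaban1984PropagatorsII, (2.9)–(2.12) p.225] -/
theorem exists_admissible_grad_of_matched' (hQd : Q ∘ₗ d = dcoarse ∘ₗ Qp) (hRR : Rp ∘ₗ Rp = Rp)
    (hRrange : ∀ v : V, ∃ n ∈ LinearMap.ker Qp, Rp v = dstar (d n)) {lam : Vc}
    (hlam : lam ∈ LinearMap.range Qp) :
    ∃ μ : V, Admissible Q dstar Rp (dcoarse lam) (d μ) := by
  obtain ⟨μ₀, rfl⟩ := LinearMap.mem_range.mp hlam
  exact exists_admissible_grad_of_matched hQd hRR hRrange μ₀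

end Matched

section MatchedHOp

variable (ΔA : A →ₗ[ℝ] A) (a : W →ₗ[ℝ] W) (dc : A →ₗ[ℝ] P) (dcs : P →ₗ[ℝ] A) (d : V →ₗ[ℝ] A)
  (dstar : A →ₗ[ℝ] V) (Rp : V →ₗ[ℝ] V) (Q : A →ₗ[ℝ] W) (Qs : W →ₗ[ℝ] A)

/-- **★ Print's own case, unconditionally in `λ`**: with `Q∂ = ∂_cQ′` (the same `Q′` as in `R`), `R` idempotent with
range in `∂*∂(N(Q′))`, and the inputs of `isCritical_unique`, `H(∂_c(Q′μ₀))` is a fine pure gauge for EVERY `μ₀`: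
`∃ μ, H(∂_c(Q′μ₀)) = ∂μ`, and `∂(H(∂_c(Q′μ₀))) = 0`. [cite: Balaban1984PropagatorsII, (2.9)–(2.12) p.225, (2.35) p.228; Balaban1985Variational, (45) p.285] -/
theorem hOp_coarseGradient_eq_grad_of_matched [FiniteDimensional ℝ A]
    (hΔa : ΔA = dcs ∘ₗ dc + d ∘ₗ Rp ∘ₗ dstar + Qs ∘ₗ a ∘ₗ Q)
    (hdc : ∀ (p : P) (x : A), ⟪dcs p, x⟫_ℝ = ⟪p, dc x⟫_ℝ)
    (hd : ∀ (v : V) (x : A), ⟪d v, x⟫_ℝ = ⟪v, dstar x⟫_ℝ) (hR : ∀ u v : V, ⟪Rp u, v⟫_ℝ = ⟪u, Rp v⟫_ℝ)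
    (hRR : Rp ∘ₗ Rp = Rp) (hQ : ∀ (w : W) (x : A), ⟪Qs w, x⟫_ℝ = ⟪w, Q x⟫_ℝ)
    (G : A →ₗ[ℝ] A) (Einv : W →ₗ[ℝ] W) (hG : G ∘ₗ ΔA = LinearMap.id)
    (h231 : Rp ∘ₗ dstar ∘ₗ G ∘ₗ d ∘ₗ Rp = Rp) (h234 : Rp ∘ₗ dstar ∘ₗ G ∘ₗ Qs = 0)
    (hE : Einv ∘ₗ (Q ∘ₗ G ∘ₗ Qs) = LinearMap.id)
    (hdcd : dc ∘ₗ d = 0) (dcoarse : Vc →ₗ[ℝ] W) (Qp : V →ₗ[ℝ] Vc) (hQd : Q ∘ₗ d = dcoarse ∘ₗ Qp)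
    (hRrange : ∀ v : V, ∃ n ∈ LinearMap.ker Qp, Rp v = dstar (d n)) (μ₀ : V) :
    ∃ μ : V, B6SectA.hOp G Qs Einv (dcoarse (Qp μ₀)) = d μ ∧ dc (B6SectA.hOp G Qs Einv (dcoarse (Qp μ₀))) = 0 := by
  obtain ⟨μ, hμ⟩ := exists_admissible_grad_of_matched (dstar := dstar) (Rp := Rp) hQd hRR hRrange μ₀
  have h := hOp_eq_grad_of_admissible_grad ΔA a dc dcs d dstar Rp Q Qs hΔa hdc hd hR hRR hQ G Einv hG h231 h234 hE
    hdcd hμ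
  exact ⟨μ, h, by rw [h]; simpa using LinearMap.congr_fun hdcd μ⟩

end MatchedHOp

/-! ## §3 Curl-factoring perturbations `Q♯ = Q + T∘curl` of the constraint operator (road R4's `Q♯ = LʲηQ_{B5} + ∂_c𝒦∘curl`) -/

section CurlShift

variable {dc : A →ₗ[ℝ] P} {Q : A →ₗ[ℝ] W} {dstar : A →ₗ[ℝ] V} {Rp : V →ₗ[ℝ] V} (T : P →ₗ[ℝ] W)

/-- On a CURL-FREE configuration the constraints `QA = B` and `(Q + T∘∂)A = B` coincide, so admissibility is the same.
[cite: Balaban1984PropagatorsII, (2.6) p.224 + (2.12) p.225] -/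
theorem admissible_curlShift_iff {B : W} {x : A} (h0 : dc x = 0) :
    Admissible (Q + T ∘ₗ dc) dstar Rp B x ↔ Admissible Q dstar Rp B x := by
  simp only [Admissible, LinearMap.add_apply, LinearMap.coe_comp, Function.comp_apply, h0, map_zero, add_zero]

/-- On a curl-free configuration criticality for `Q + T∘∂` and for `Q` coincide (both first variations vanish identically).
[cite: Balaban1984PropagatorsII, (2.5)–(2.6) p.224] -/
theorem isCritical_curlShift_iff_of_dc_eq_zero {B : W} {x : A} (h0 : dc x = 0) :
    IsCritical dc (Q + T ∘ₗ dc) dstar Rp B x ↔ IsCritical dc Q dstar Rp B x := by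
  constructor
  · intro h
    exact isCritical_of_admissible_of_dc_eq_zero ((admissible_curlShift_iff T h0).mp h.1) h0
  · intro h
    exact isCritical_of_admissible_of_dc_eq_zero ((admissible_curlShift_iff T h0).mpr h.1) h0

/-- **★ The flat kernel is insensitive to curl-factoring perturbations**: the homogeneous system
`∂A = 0 ∧ R∂*A = 0 ∧ Q♯A = 0` has only the zero solution iff the same holds for `Q` — so the positivity of
`Δ_a♯ = ∂*∂ + ∂R∂* + Q♯*aQ♯` on closed forms (the existence of `H♯`) is print's own positivity of `Δ_a`.
[cite: Balaban1984PropagatorsII, (2.19) p.226, (2.22) p.226] -/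
theorem flat_kernel_curlShift_iff :
    (∀ x : A, dc x = 0 → Rp (dstar x) = 0 → (Q + T ∘ₗ dc) x = 0 → x = 0) ↔
      (∀ x : A, dc x = 0 → Rp (dstar x) = 0 → Q x = 0 → x = 0) := by
  have key : ∀ x : A, dc x = 0 → ((Q + T ∘ₗ dc) x = 0 ↔ Q x = 0) := fun x h0 => by
    simp only [LinearMap.add_apply, LinearMap.coe_comp, Function.comp_apply, h0, map_zero, add_zero]
  constructor
  · intro h x h0 hR hQ
    exact h x h0 hR ((key x h0).mpr hQ)
  · intro h x h0 hR hQ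
    exact h x h0 hR ((key x h0).mp hQ)

/-- The quadratic form `‖∂x‖² + ⟨∂*x, R∂*x⟩ + ⟨Qx, aQx⟩` of (2.19) vanishes on `x` exactly when `x` lies in the flat kernel,
provided `R` is an orthogonal projection and `a` is positive definite on `W` — the link between `flat_kernel_curlShift_iff`
and the positivity of `Δ_a`. [cite: Balaban1984PropagatorsII, (2.19) p.226, (2.22) p.226] -/
theorem form219_eq_zero_iff {a : W →ₗ[ℝ] W} (hR : ∀ u v : V, ⟪Rp u, v⟫_ℝ = ⟪u, Rp v⟫_ℝ) (hRR : Rp ∘ₗ Rp = Rp)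
    (ha : ∀ w : W, 0 ≤ ⟪w, a w⟫_ℝ) (ha0 : ∀ w : W, ⟪w, a w⟫_ℝ = 0 → w = 0) (x : A) :
    ‖dc x‖ ^ 2 + ⟪dstar x, Rp (dstar x)⟫_ℝ + ⟪Q x, a (Q x)⟫_ℝ = 0 ↔ dc x = 0 ∧ Rp (dstar x) = 0 ∧ Q x = 0 := by
  have hRsq : ⟪dstar x, Rp (dstar x)⟫_ℝ = ‖Rp (dstar x)‖ ^ 2 := by
    have h1 : Rp (Rp (dstar x)) = Rp (dstar x) := by
      simpa only [LinearMap.coe_comp, Function.comp_apply] using LinearMap.congr_fun hRR (dstar x)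
    rw [← h1, ← hR, h1, real_inner_self_eq_norm_sq]
  rw [hRsq]
  constructor
  · intro h
    have h1 : 0 ≤ ‖dc x‖ ^ 2 := by positivity
    have h2 : 0 ≤ ‖Rp (dstar x)‖ ^ 2 := by positivity
    have h3 := ha (Q x)
    have e1 : ‖dc x‖ ^ 2 = 0 := by linarith
    have e2 : ‖Rp (dstar x)‖ ^ 2 = 0 := by linarith
    have e3 : ⟪Q x, a (Q x)⟫_ℝ = 0 := by linarith
    refine ⟨?_, ?_, ha0 _ e3⟩
    · exact norm_eq_zero.mp (pow_eq_zero_iff (n := 2) two_ne_zero |>.mp e1)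
    · exact norm_eq_zero.mp (pow_eq_zero_iff (n := 2) two_ne_zero |>.mp e2)
  · rintro ⟨h0, hR0, hQ0⟩
    simp [h0, hR0, hQ0]

end CurlShift

section CurlShiftHOp

variable (ΔA : A →ₗ[ℝ] A) (a : W →ₗ[ℝ] W) (dc : A →ₗ[ℝ] P) (dcs : P →ₗ[ℝ] A) (d : V →ₗ[ℝ] A)
  (dstar : A →ₗ[ℝ] V) (Rp : V →ₗ[ℝ] V) (Qsh : A →ₗ[ℝ] W) (Qshs : W →ₗ[ℝ] A)

/-- **`H♯` of a coarse pure gauge is the SAME fine pure gauge** (R4's `Q♯ = Q + T∘curl`): if `Q∂ = ∂_cE`, `∂μ` satisfies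
`∂_c(Eμ) = ∂_cλ`, `R∂*∂μ = 0`, and the [B6] Sect. A inputs hold for `Q♯ := Q + T∘∂` (its own `Δ_a♯`, `G♯`, `E♯`), then
`H♯(∂_cλ) = ∂μ` — the admissibility of `∂μ` being the same for `Q♯` and `Q`.
[cite: Balaban1984PropagatorsII, (2.35) p.228; Balaban1985Variational, (45) p.285, (157) p.302] -/
theorem hOp_curlShift_coarseGradient_eq_grad [FiniteDimensional ℝ A]
    (hΔa : ΔA = dcs ∘ₗ dc + d ∘ₗ Rp ∘ₗ dstar + Qshs ∘ₗ a ∘ₗ Qsh)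
    (hdc : ∀ (p : P) (x : A), ⟪dcs p, x⟫_ℝ = ⟪p, dc x⟫_ℝ)
    (hd : ∀ (v : V) (x : A), ⟪d v, x⟫_ℝ = ⟪v, dstar x⟫_ℝ) (hR : ∀ u v : V, ⟪Rp u, v⟫_ℝ = ⟪u, Rp v⟫_ℝ)
    (hRR : Rp ∘ₗ Rp = Rp) (hQ : ∀ (w : W) (x : A), ⟪Qshs w, x⟫_ℝ = ⟪w, Qsh x⟫_ℝ)
    (G : A →ₗ[ℝ] A) (Einv : W →ₗ[ℝ] W) (hG : G ∘ₗ ΔA = LinearMap.id)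
    (h231 : Rp ∘ₗ dstar ∘ₗ G ∘ₗ d ∘ₗ Rp = Rp) (h234 : Rp ∘ₗ dstar ∘ₗ G ∘ₗ Qshs = 0)
    (hE : Einv ∘ₗ (Qsh ∘ₗ G ∘ₗ Qshs) = LinearMap.id)
    (hdcd : dc ∘ₗ d = 0) (Q : A →ₗ[ℝ] W) (T : P →ₗ[ℝ] W) (hsh : Qsh = Q + T ∘ₗ dc)
    (dcoarse : Vc →ₗ[ℝ] W) (E : V →ₗ[ℝ] Vc) (hQd : Q ∘ₗ d = dcoarse ∘ₗ E)
    {lam : Vc} {μ : V} (hEμ : dcoarse (E μ) = dcoarse lam) (hRμ : Rp (dstar (d μ)) = 0) :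
    B6SectA.hOp G Qshs Einv (dcoarse lam) = d μ ∧ dc (B6SectA.hOp G Qshs Einv (dcoarse lam)) = 0 := by
  have h0 : dc (d μ) = 0 := by simpa using LinearMap.congr_fun hdcd μ
  have hμQ : Admissible Q dstar Rp (dcoarse lam) (d μ) := (admissible_grad_iff hQd lam μ).mpr ⟨hEμ, hRμ⟩
  have hμ : Admissible Qsh dstar Rp (dcoarse lam) (d μ) := by
    rw [hsh]; exact (admissible_curlShift_iff T h0).mpr hμQ
  have h := hOp_eq_grad_of_admissible_grad ΔA a dc dcs d dstar Rp Qsh Qshs hΔa hdc hd hR hRR hQ G Einv hG h231 h234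
    hE hdcd hμ
  exact ⟨h, by rw [h]; exact h0⟩

end CurlShiftHOp

/-! ## §4 Print's own model (lit-balaban p21/r03's concrete [B6] Sect. A): `H(Q∂μ₀)` is a fine pure gauge, no hypothesis -/

section ConcreteV1

variable {Pm : Params} (D : Domains Pm) {c : ℝ} (hc : c ≠ 0) {w : BondIdx D → ℝ} (hw : ∀ i, 0 < w i)

/-- **Feasibility on the model** ((2.9)/(2.12) read backwards): for every scalar `μ₀` there is `n ∈ N(Q′)` — the one with
`R(∂*∂μ₀) = ∂*∂n` (`RE_range`) — such that the pure gauge `∂(μ₀ − n)` is admissible at the datum `Q(∂μ₀)`: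
`Q∂(μ₀ − n) = Q∂μ₀` (`QE_dE_eq_zero`: pure gauges in `N(Q′)` satisfy the homogeneous constraints, (1.20)) and
`R∂*∂(μ₀ − n) = R(∂*∂μ₀) − R(R∂*∂μ₀) = 0` (`RE_comp_RE`). [cite: Balaban1984PropagatorsII, (2.9)–(2.12) p.225, (2.29)–(2.30) p.227] -/
theorem exists_admissible_dE_V1 (c : ℝ) (μ₀ : ScalarSpace Pm) :
    ∃ n ∈ LinearMap.ker (QpE D), Admissible (QE D) (dsE c) (RE D c) (QE D (dE c μ₀)) (dE c (μ₀ - n)) := by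
  obtain ⟨n, hn, hRn⟩ := RE_range D c (dsE c (dE c μ₀))
  refine ⟨n, hn, ?_, ?_⟩
  · rw [map_sub, map_sub, QE_dE_eq_zero D c n hn, sub_zero]
  · have hRR : RE D c (RE D c (dsE c (dE c μ₀))) = RE D c (dsE c (dE c μ₀)) := by
      simpa only [LinearMap.coe_comp, Function.comp_apply] using LinearMap.congr_fun (RE_comp_RE D c) (dsE c (dE c μ₀))
    rw [map_sub, map_sub, map_sub, ← hRn, hRR, sub_self]

/-- **★★ `H(Q∂μ₀) = ∂μ` ON PRINT'S MODEL, for every `μ₀`, every nested family `D`, every lattice factor `c ≠ 0` and weights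
`w > 0`**: print's `H = GQ*(QGQ*)⁻¹` (2.35) applied to the averaged pure gauge `Q(∂μ₀)` (= the coarse pure gauge
`∂^{(j)}Q′_jμ₀` on each `Λ_j`, (1.20)) IS the fine pure gauge `∂(μ₀ − n)` of `exists_admissible_dE_V1` — by
`isCritical_iff_eq_hOp` (uniqueness of the critical configuration) and `∂∂ = 0` (`dcE_comp_dE`).
[cite: Balaban1984PropagatorsII, (2.35) p.228; Balaban1985Variational, (45)-(46) p.285] -/
theorem hOp_QE_dE_eq_dE_V1 (μ₀ : ScalarSpace Pm) :
    ∃ n ∈ LinearMap.ker (QpE D),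
      B6SectA.hOp (GE D hc hw) (QsE D) (EE D hc hw) (QE D (dE c μ₀)) = dE c (μ₀ - n) := by
  obtain ⟨n, hn, hadm⟩ := exists_admissible_dE_V1 D c μ₀
  refine ⟨n, hn, ?_⟩
  have hcrit : IsCritical (dcE c) (QE D) (dsE c) (RE D c) (QE D (dE c μ₀)) (dE c (μ₀ - n)) :=
    isCritical_grad (dcE_comp_dE c) hadm
  exact ((isCritical_iff_eq_hOp D hc hw (QE D (dE c μ₀)) (dE c (μ₀ - n))).mp hcrit).symm

/-- Hence the plaquette variables of `H(Q∂μ₀)` vanish identically. [cite: Balaban1984PropagatorsII, (2.5) p.224, (2.35) p.228] -/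
theorem dcE_hOp_QE_dE_V1 (μ₀ : ScalarSpace Pm) :
    dcE c (B6SectA.hOp (GE D hc hw) (QsE D) (EE D hc hw) (QE D (dE c μ₀))) = 0 := by
  obtain ⟨n, _, h⟩ := hOp_QE_dE_eq_dE_V1 D hc hw μ₀
  rw [h]
  simpa using LinearMap.congr_fun (dcE_comp_dE (P := Pm) c) (μ₀ - n)

/-- The energy (2.5) of `H(Q∂μ₀)` is zero. [cite: Balaban1984PropagatorsII, (2.5) p.224, (2.35) p.228] -/
theorem energy_hOp_QE_dE_V1 (μ₀ : ScalarSpace Pm) :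
    energy (dcE c) (B6SectA.hOp (GE D hc hw) (QsE D) (EE D hc hw) (QE D (dE c μ₀))) = 0 := by
  simp [energy, dcE_hOp_QE_dE_V1 D hc hw μ₀]

end ConcreteV1

end Summit.QuantumFields.YangMills.Theorems.N07FlatHOfCoarseGradient

end
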